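import Summits.AtomisticToContinuum.BoseEinsteinCondensation.Theorems.PeriodicIRBound.Negative.TwoModeStates

/-!
# Negative lemmas for crux `PeriodicIRBound` (stmt-AtomisticToContinuum-3972), III: consistency at
`v = 0` and non-vacuity

Supports (does not close) stmt-AtomisticToContinuum-3972, route `BECGroundStateSOS`. Landed copy of
§9–§10 of `Cruxes/PeriodicIRBound/Disproof.lean` (cycle 1); all `sorry`-free.

* §9 `irBoundWith_zero`, `irBoundFor_zero` — the free gas satisfies the crux for every `κ`, `ρ₀` and
  EVERY `C > 0` (`δ_N := 4π²C√ρ/L_N`; kinetic Markov bound `cellOccupation_le_energy_div :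
  n_k ≤ ⟨Ψ,HΨ⟩L²/(4π²|k|₂²)` from the Parseval gradient identity; the window is not used). Nothing in the
  crux bounds `C` from below without interaction.
* §10 `eventually_exists_nearMin` — for every admissible `v` (hard cores included), below `ρ₁(v)` and
  eventually in `N`, every slack `δ > 0` has a finite-energy `δ`-near-minimiser: the crux is not
  vacuous.
-/

noncomputable section

open MeasureTheory Filter
open scoped ENNReal NNReal ComplexConjugate BigOperators
namespace Summit.AtomisticToContinuum.BoseEinsteinCondensation.Theorems.PeriodicIRBound.Negative

open Literature.MathematicalPhysics.QuantumManyBody.BoseGas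
open Summit.AtomisticToContinuum.BoseEinsteinCondensation.Theses.BECGroundStateSOS
open Summit.AtomisticToContinuum.BoseEinsteinCondensation.Theorems.GaussianDominationCan.Negative
  (symState symFun oneBody periodicEnergy_symState nsq nsq_nonneg e0 e0_ne_zero norm_e0
    nsq_e0 one_le_norm_intVec lintegral_nnnorm_sq_prodFun lintegral_nnnorm_sq_oneBody
    continuous_oneBody integral_cell_const conj_cellWave_mul_self integral_cell_conj_cellWave
    isRepulsiveFiniteRange_zero)
open Summit.AtomisticToContinuum.BoseEinsteinCondensation.Theorems.GaussianDominationCan.Negative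
  renaming prodFun → gdProd
open Summit.AtomisticToContinuum.BoseEinsteinCondensation.Theorems.CorrectorClosure.Negative
  (hardCore isRepulsiveFiniteRange_hardCore periodicEnergy_hardCore_eq_top
    periodicGroundStateEnergy_one_eq_top)

variable {L : ℝ} {m : ℕ} {n : Fin 3 → ℤ} {a b : ℝ}

/-! ## §9 CONSISTENCY: the free gas satisfies the crux with EVERY constant `C > 0` -/

/-- `‖k‖_∞ ≤ |k|₂² = nsq k` on `ℤ³` (each `|k_j| ≤ k_j²` for an integer). [folklore] -/
theorem norm_intVec_le_nsq (k : Fin 3 → ℤ) : ‖(fun j => (k j : ℝ))‖ ≤ nsq k := by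
  refine (pi_norm_le_iff_of_nonneg (nsq_nonneg k)).2 fun j => ?_
  rw [Real.norm_eq_abs]
  have h : |(k j : ℝ)| ≤ (k j : ℝ) ^ 2 := by
    rcases eq_or_ne (k j) 0 with h0 | h0
    · simp [h0]
    · have h1 : (1 : ℝ) ≤ |(k j : ℝ)| := by exact_mod_cast Int.one_le_abs h0
      nlinarith [sq_abs (k j : ℝ), abs_nonneg (k j : ℝ)]
  exact h.trans (Finset.single_le_sum (fun i _ => sq_nonneg ((k i : ℝ))) (Finset.mem_univ j))

/-- `1 ≤ nsq k` for `k ≠ 0`. [folklore] -/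
theorem one_le_nsq {k : Fin 3 → ℤ} (hk : k ≠ 0) : 1 ≤ nsq k :=
  (one_le_norm_intVec hk).trans (norm_intVec_le_nsq k)

/-- `fracDispersion 2 L k = ofReal (4π² nsq k / L²)`. [folklore] -/
theorem fracDispersion_two_nsq (L : ℝ) (k : Fin 3 → ℤ) :
    fracDispersion 2 L k = ENNReal.ofReal (4 * Real.pi ^ 2 * nsq k / L ^ 2) := by
  rw [fracDispersion_two]
  rfl

/-- **Kinetic Markov bound** (any `v`, any periodic state): `|2πk/L|² · n_k(Ψ) ≤ ⟨Ψ, H Ψ⟩` — one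
term of the Parseval gradient identity `∑_p |2πp/L|² n_p = ∫|∇Ψ|²` (in tree:
`tsum_fracDispersion_two_mul_cellOccupation`), and `v ≥ 0`. [folklore] -/
theorem fracDispersion_mul_cellOccupation_le {N : ℕ} (hL : 0 < L) (v : ℝ → ℝ≥0∞)
    (Ψ : PeriodicTrialState N L) (k : Fin 3 → ℤ) :
    fracDispersion 2 L k * cellOccupation N L (planeWaveMode L k) Ψ.ψ ≤ periodicEnergy v Ψ := by
  calc fracDispersion 2 L k * cellOccupation N L (planeWaveMode L k) Ψ.ψ
      ≤ ∑' p : Fin 3 → ℤ, fracDispersion 2 L p * cellOccupation N L (planeWaveMode L p) Ψ.ψ :=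
        ENNReal.le_tsum k
    _ = ∫⁻ X in cellN N L, kineticDensity Ψ.ψ X := tsum_fracDispersion_two_mul_cellOccupation hL Ψ
    _ ≤ periodicEnergy v Ψ := lintegral_mono fun X => le_self_add

/-- Hence `n_k(Ψ) ≤ ⟨Ψ,HΨ⟩ · L²/(4π²|k|₂²)` for `k ≠ 0` (for a `δ`-near-minimiser:
`≤ (E₀^{per} + δ) L²/(4π²|k|₂²)`). The crux's inequality is therefore trivially true in the
ULTRAVIOLET `|k|₂² ≥ (E₀ + δ) L /(4π² C √ρ)`; with `E₀ ∼ 4πaρN` that is `‖k‖ ≳ a ρ^{3/2} L⁴`, far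
outside the window `‖k‖ ≤ κ√ρ L`: the whole content of the crux is the SUBTRACTION of `E₀`, i.e. an
infrared bound on the excitations of the near-minimiser, not on its energy. [folklore] -/
theorem cellOccupation_le_energy_div {N : ℕ} (hL : 0 < L) (v : ℝ → ℝ≥0∞)
    (Ψ : PeriodicTrialState N L) {k : Fin 3 → ℤ} (hk : k ≠ 0) :
    cellOccupation N L (planeWaveMode L k) Ψ.ψ ≤ periodicEnergy v Ψ / fracDispersion 2 L k := by
  have hpos : 0 < 4 * Real.pi ^ 2 * nsq k / L ^ 2 :=
    div_pos (mul_pos (by positivity) (by linarith [one_le_nsq hk])) (pow_pos hL 2)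
  have hD0 : fracDispersion 2 L k ≠ 0 := by
    rw [fracDispersion_two_nsq]; exact (ENNReal.ofReal_pos.2 hpos).ne'
  rw [ENNReal.le_div_iff_mul_le (Or.inl hD0) (Or.inl (fracDispersion_ne_top 2 L k)), mul_comm]
  exact fracDispersion_mul_cellOccupation_le hL v Ψ k

/-- The crux for one potential with the constants made explicit. -/
def IRBoundWith (v : ℝ → ℝ≥0∞) (κ ρ₀ C : ℝ) : Prop :=
  ∀ ρ : ℝ, 0 < ρ → ρ < ρ₀ → ∀ᶠ N : ℕ in atTop, ∃ δ : ℝ≥0∞, 0 < δ ∧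
    ∀ Ψ : PeriodicTrialState N (sideLength ρ N), NearMin v ρ N δ Ψ →
      ∀ k : Fin 3 → ℤ, InWindow κ ρ N k → IRIneq C ρ N Ψ.ψ k

/-- `IRBoundFor v ↔ ∀ κ > 0, ∃ ρ₀ > 0, ∃ C > 0, IRBoundWith v κ ρ₀ C`. [folklore] -/
theorem irBoundFor_iff (v : ℝ → ℝ≥0∞) :
    IRBoundFor v ↔ ∀ κ : ℝ, 0 < κ → ∃ ρ₀ : ℝ, 0 < ρ₀ ∧ ∃ C : ℝ, 0 < C ∧ IRBoundWith v κ ρ₀ C :=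
  Iff.rfl

/-- **Free-gas infrared bound, NO momentum cutoff**: on the torus of side `L_N`, every
`δ_N`-near-minimiser of the FREE energy, `δ_N := 4π² C √ρ / L_N`, satisfies `n_k ≤ C√ρ L_N/‖k‖_∞` for
EVERY `k ≠ 0` and every `C > 0` (`E₀^{per} = 0`, kinetic Markov bound
`n_k ≤ δ L²/(4π²|k|₂²)`, and `‖k‖_∞ ≤ |k|₂²` on `ℤ³`). The upper cutoff `‖k‖ ≤ κ√ρL` of the crux is
idle here. [folklore] -/
theorem free_irIneq {ρ C : ℝ} (hρ : 0 < ρ) (hC : 0 < C) {N : ℕ} (hN : 0 < N)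
    (Ψ : PeriodicTrialState N (sideLength ρ N))
    (hΨ : NearMin 0 ρ N (ENNReal.ofReal (4 * Real.pi ^ 2 * C * Real.sqrt ρ / sideLength ρ N)) Ψ)
    {k : Fin 3 → ℤ} (hk0 : k ≠ 0) : IRIneq C ρ N Ψ.ψ k := by
  have hL := sideLength_pos_of_pos hρ hN
  have hπ : (0 : ℝ) < 4 * Real.pi ^ 2 := by positivity
  have hnsq := one_le_nsq hk0
  have hnorm := one_le_norm_intVec hk0
  rw [irIneq_iff]
  refine (cellOccupation_le_energy_div hL 0 Ψ hk0).trans ?_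
  unfold NearMin at hΨ
  rw [periodicGroundStateEnergy_zero_eq_zero N hL, zero_add] at hΨ
  calc periodicEnergy 0 Ψ / fracDispersion 2 (sideLength ρ N) k
      ≤ ENNReal.ofReal (4 * Real.pi ^ 2 * C * Real.sqrt ρ / sideLength ρ N) /
          fracDispersion 2 (sideLength ρ N) k := by
        gcongr
    _ = ENNReal.ofReal ((4 * Real.pi ^ 2 * C * Real.sqrt ρ / sideLength ρ N) /
          (4 * Real.pi ^ 2 * nsq k / sideLength ρ N ^ 2)) := by
        have hpos : (0 : ℝ) < 4 * Real.pi ^ 2 * nsq k / sideLength ρ N ^ 2 :=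
          div_pos (mul_pos hπ (by linarith)) (pow_pos hL 2)
        rw [fracDispersion_two_nsq, ← ENNReal.ofReal_div_of_pos hpos]
    _ = ENNReal.ofReal (C * Real.sqrt ρ * sideLength ρ N / nsq k) := by
        congr 1
        field_simp
    _ ≤ ENNReal.ofReal (C * Real.sqrt ρ * sideLength ρ N / ‖(fun j => (k j : ℝ))‖) := by
        apply ENNReal.ofReal_le_ofReal
        exact div_le_div_of_nonneg_left (by positivity) (by linarith) (norm_intVec_le_nsq k)

/-- **The free gas satisfies the crux for EVERY `κ`, `ρ₀` and EVERY constant `C > 0`** (by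
`free_irIneq`; the window is not used). So the crux is consistent, its hypotheses are jointly
satisfiable with a non-trivial conclusion, and NOTHING in it pins the constant from below without
interaction: `C ∼ √a` (Bogoliubov `n_p ≈ √(πρa)/|p|`) can only be tested on a genuinely interacting
`v`, for which no per-mode lower bound on the depletion is in print. [folklore] -/
theorem irBoundWith_zero {κ ρ₀ C : ℝ} (hC : 0 < C) : IRBoundWith 0 κ ρ₀ C := by
  intro ρ hρ _
  filter_upwards [eventually_gt_atTop 0] with N hN
  have hL := sideLength_pos_of_pos hρ hN
  exact ⟨ENNReal.ofReal (4 * Real.pi ^ 2 * C * Real.sqrt ρ / sideLength ρ N),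
    ENNReal.ofReal_pos.2 (by positivity), fun Ψ hΨ k hk => free_irIneq hρ hC hN Ψ hΨ hk.1⟩

/-- In particular `IRBoundFor 0`: the free gas is no counterexample (with `ρ₀ = 1`, `C = 1`, any `κ`).
[folklore] -/
theorem irBoundFor_zero : IRBoundFor 0 := fun _ _ =>
  ⟨1, one_pos, 1, one_pos, irBoundWith_zero one_pos⟩

/-! ## §10 NON-VACUITY of the hypothesis for EVERY admissible `v` -/

/-- **The near-minimiser class is eventually non-empty** (every repulsive finite-range `v`, hard
cores included): below `ρ₁(v) = 1/(2(1+R)³)` and for all large `N`, `E₀^{per}(N, L_N) < ⊤`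
(tree: `exists_eventually_periodicGroundStateEnergy_lt_top`, Ruelle finiteness below close
packing), so for EVERY slack `δ > 0` there is a `δ`-near-minimiser of finite energy. The crux is
not vacuously true: its conclusion is tested, at each large `N`, on states `δ_N`-close to the ground
state. [folklore] -/
theorem eventually_exists_nearMin {v : ℝ → ℝ≥0∞} (hv : IsRepulsiveFiniteRange v) :
    ∃ ρ₁ : ℝ, 0 < ρ₁ ∧ ∀ ρ : ℝ, 0 < ρ → ρ < ρ₁ → ∀ᶠ N : ℕ in atTop, ∀ δ : ℝ≥0∞, 0 < δ →
      ∃ Ψ : PeriodicTrialState N (sideLength ρ N), NearMin v ρ N δ Ψ ∧ periodicEnergy v Ψ < ⊤ := by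
  obtain ⟨ρ₁, hρ₁, h⟩ :=
    Literature.Barriers.AtomisticToContinuum.BoseGas.exists_eventually_periodicGroundStateEnergy_lt_top
      hv
  refine ⟨ρ₁, hρ₁, fun ρ hρ hρρ₁ => ?_⟩
  filter_upwards [h ρ hρ hρρ₁] with N hN δ hδ
  have hlt : periodicGroundStateEnergy v N (sideLength ρ N) <
      periodicGroundStateEnergy v N (sideLength ρ N) + δ := ENNReal.lt_add_right hN.ne hδ.ne'
  obtain ⟨Ψ, hΨ⟩ := iInf_lt_iff.1 hlt
  exact ⟨Ψ, hΨ.le, lt_of_lt_of_le hΨ le_top⟩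

end Summit.AtomisticToContinuum.BoseEinsteinCondensation.Theorems.PeriodicIRBound.Negative

end
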